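import Summits.CriticalPhenomena.PercolationContinuityZ3.Theorems.PercNearOneGluingNoHeavyLowerTailPivotCertificate
import HarnessLib

/-!
# `NoHeavyLowerTail` (stmt-CriticalPhenomena-4575) — CHAMPION CERTIFICATES (the refutable residual of the observer-set line)

Support file (lemma factory `prim-lf-6`; `--supports stmt-CriticalPhenomena-4575`).  No definitions, no named facts, no sorries.
`…PivotCertificate.lean` proves that PIVOT CERTIFICATES are sound for CST@champion and remarks that the unrestricted calculus is COMPLETE (its optimal
value equals the target quantity), so "a certificate exists" is the target itself.  The statement with content is the existence of a certificate whose
every designee switch goes to a CHAMPION of the child graph (`∀ b ∈ A, I_child(b) ≤ I_child(d_b)`): this is what every strategy censused so far produces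
(GCC ⊂ F1 ⊂ F2 ⊂ ttrl2's L0–L3; `run/shared/lean/ttrl/lf6/GCC.md`, `run/shared/lean/prim/prim-lf-6/CANDIDATES.md`), it is decidable per instance by a finite
search, and it is STRICTLY stronger than CST@champion (the complete strategy switches to the absorbed relay, which is in general not a champion).
Evidence: F1 alone certifies 1 747 / 1 747 random roots (n ≤ 8, k ≤ 5); F2 certifies all 127 nodes where the single-designee GCC fails; no uncertified
instance is known.  The hypothesis `hCert` of `cst_of_championCertificate` (= the pivot-certificate hypothesis with champion premises added to the two pivot
rules) is the candidate stub `stub_championCertificate`; soundness is the same semantic argument (`Good := β ≤ A`, the extra premises are not needed).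

**Theorems.** `cst_of_championCertificate`, `cumulativeIsolation_of_championCertificate : hCert → stub_cumulativeIsolation`,
`noHeavyLowerTail_of_championCertificate : hCert → NoHeavyLowerTail`.
-/

noncomputable section

namespace Summit.CriticalPhenomena.PercolationContinuityZ3.Theorems

open MeasureTheory Set Literature.Probability.LatticeModels Literature.Probability.Percolation
open scoped Classical BigOperators

variable {n : ℕ}

open PivotCertificate GreedyComparator ChampionStability

/-! ### Soundness of CHAMPION certificates (pivot certificates whose every switch target is a champion of its child graph) -/

/-- **Soundness of champion certificates.**  Same as `cst_of_pivotCertificate` with the two pivot rules restricted to CHAMPION designees of the child graphs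
(extra premises, simply not used by the semantic predicate); the hypothesis `hCert` here is the candidate stub `stub_championCertificate`.  If every root `(w, x, a₀)` (free observer `x`, champion `a₀`) has a pivot certificate — `Good(w,{x},a₀,0)`
for every predicate `Good` closed under the five certificate rules (module docstring) — then `A_w({x};a₀,a₀) ≥ 0` (CST@champion at `x`).
Proof: `Good(w',T',d,β) := β ≤ A_{w'}(T';d,a₀)` is closed under the rules (`base_ge`, `relay_leaf_nonneg`, the one-bond decomposition
`stub_oneBondDecomp_k15` / with absorption `real_eq_oneBond_shift` + `preimage_insert_*`, the switch identity `real_E2_eq`, and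
`real_update_one_eq_zero_of_absorbed` for the convention `c = 1`). -/
theorem cst_of_championCertificate
    (hCert : ∀ (n : ℕ) (w : Sym2 (Fin n) → unitInterval) (A : Finset (Fin n)) (j : ℕ) (x a₀ : Fin n),
      x ∉ A → a₀ ∈ A →
      (∀ b ∈ A, (prodBernoulli w).real {ω : BondConfig (Fin n) | (A.filter fun u => ω ∈ openConn b u).card ≤ j} ≤ (prodBernoulli w).real {ω : BondConfig (Fin n) | (A.filter fun u => ω ∈ openConn a₀ u).card ≤ j}) →
      ∀ Good : (Sym2 (Fin n) → unitInterval) → Finset (Fin n) → Fin n → ℝ → Prop,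
        (∀ (w' : Sym2 (Fin n) → unitInterval) (T' : Finset (Fin n)) (d : Fin n) (β β' : ℝ),
          Good w' T' d β → β' ≤ β → Good w' T' d β') →
        (∀ (w' : Sym2 (Fin n) → unitInterval) (T' : Finset (Fin n)) (d : Fin n), Disjoint T' A → d ∈ A →
          (∀ y ∈ T', ∀ z : Fin n, z ∉ T' → w' s(y, z) = 0) →
          Good w' T' d ((prodBernoulli w').real {ω : BondConfig (Fin n) | (A.filter fun u => ω ∈ openConn d u).card ≤ j} - (prodBernoulli w').real {ω : BondConfig (Fin n) | (A.filter fun u => ω ∈ openConn a₀ u).card ≤ j})) →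
        (∀ (w' : Sym2 (Fin n) → unitInterval) (T' : Finset (Fin n)) (d r : Fin n), r ∈ T' → r ∈ A →
          (prodBernoulli w').real {ω : BondConfig (Fin n) | (A.filter fun u => ω ∈ openConn r u).card ≤ j} ≤ (prodBernoulli w').real {ω : BondConfig (Fin n) | (A.filter fun u => ω ∈ openConn d u).card ≤ j} →
          Good w' T' d 0) →
        (∀ (w' : Sym2 (Fin n) → unitInterval) (T' : Finset (Fin n)) (d d₀ d₁ : Fin n) (e : Sym2 (Fin n)) (β₀ β₁ : ℝ),
          d ∈ A → d₀ ∈ A → d₁ ∈ A →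
          (∀ b ∈ A, (prodBernoulli (Function.update w' e 0)).real {ω : BondConfig (Fin n) | (A.filter fun u => ω ∈ openConn b u).card ≤ j} ≤ (prodBernoulli (Function.update w' e 0)).real {ω : BondConfig (Fin n) | (A.filter fun u => ω ∈ openConn d₀ u).card ≤ j}) →
          (∀ b ∈ A, (prodBernoulli (Function.update w' e 1)).real {ω : BondConfig (Fin n) | (A.filter fun u => ω ∈ openConn b u).card ≤ j} ≤ (prodBernoulli (Function.update w' e 1)).real {ω : BondConfig (Fin n) | (A.filter fun u => ω ∈ openConn d₁ u).card ≤ j}) →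
          Good (Function.update w' e 0) T' d₀ β₀ → Good (Function.update w' e 1) T' d₁ β₁ →
          Good w' T' d ((1 - (w' e : ℝ)) * β₀ + (w' e : ℝ) * β₁ +
            (1 - (w' e : ℝ)) * (((prodBernoulli (Function.update w' e 0)).real {ω : BondConfig (Fin n) | (∀ t ∈ T', ω ∉ openConn d t) ∧ (A.filter fun u => ω ∈ openConn d u).card ≤ j} + (prodBernoulli (Function.update w' e 0)).real {ω : BondConfig (Fin n) | (∃ t ∈ T', ω ∈ openConn d t) ∧ (A.filter fun u => ∃ t ∈ T', ω ∈ openConn t u).card ≤ j}) - ((prodBernoulli (Function.update w' e 0)).real {ω : BondConfig (Fin n) | (∀ t ∈ T', ω ∉ openConn d₀ t) ∧ (A.filter fun u => ω ∈ openConn d₀ u).card ≤ j} + (prodBernoulli (Function.update w' e 0)).real {ω : BondConfig (Fin n) | (∃ t ∈ T', ω ∈ openConn d₀ t) ∧ (A.filter fun u => ∃ t ∈ T', ω ∈ openConn t u).card ≤ j})) +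
            (w' e : ℝ) * (((prodBernoulli (Function.update w' e 1)).real {ω : BondConfig (Fin n) | (∀ t ∈ T', ω ∉ openConn d t) ∧ (A.filter fun u => ω ∈ openConn d u).card ≤ j} + (prodBernoulli (Function.update w' e 1)).real {ω : BondConfig (Fin n) | (∃ t ∈ T', ω ∈ openConn d t) ∧ (A.filter fun u => ∃ t ∈ T', ω ∈ openConn t u).card ≤ j}) - ((prodBernoulli (Function.update w' e 1)).real {ω : BondConfig (Fin n) | (∀ t ∈ T', ω ∉ openConn d₁ t) ∧ (A.filter fun u => ω ∈ openConn d₁ u).card ≤ j} + (prodBernoulli (Function.update w' e 1)).real {ω : BondConfig (Fin n) | (∃ t ∈ T', ω ∈ openConn d₁ t) ∧ (A.filter fun u => ∃ t ∈ T', ω ∈ openConn t u).card ≤ j})))) →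
        (∀ (w' : Sym2 (Fin n) → unitInterval) (T' : Finset (Fin n)) (d d₀ d₁ y z : Fin n) (c : unitInterval) (β₀ β₁ : ℝ),
          d ∈ A → d₀ ∈ A → d₁ ∈ A → y ∈ T' → z ∉ T' → (c = 0 ∨ c = 1) →
          (∀ b ∈ A, (prodBernoulli (Function.update w' s(y, z) 0)).real {ω : BondConfig (Fin n) | (A.filter fun u => ω ∈ openConn b u).card ≤ j} ≤ (prodBernoulli (Function.update w' s(y, z) 0)).real {ω : BondConfig (Fin n) | (A.filter fun u => ω ∈ openConn d₀ u).card ≤ j}) →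
          (∀ b ∈ A, (prodBernoulli (Function.update w' s(y, z) c)).real {ω : BondConfig (Fin n) | (A.filter fun u => ω ∈ openConn b u).card ≤ j} ≤ (prodBernoulli (Function.update w' s(y, z) c)).real {ω : BondConfig (Fin n) | (A.filter fun u => ω ∈ openConn d₁ u).card ≤ j}) →
          Good (Function.update w' s(y, z) 0) T' d₀ β₀ → Good (Function.update w' s(y, z) c) (insert z T') d₁ β₁ →
          Good w' T' d ((1 - (w' s(y, z) : ℝ)) * β₀ + (w' s(y, z) : ℝ) * β₁ +
            (1 - (w' s(y, z) : ℝ)) * (((prodBernoulli (Function.update w' s(y, z) 0)).real {ω : BondConfig (Fin n) | (∀ t ∈ T', ω ∉ openConn d t) ∧ (A.filter fun u => ω ∈ openConn d u).card ≤ j} + (prodBernoulli (Function.update w' s(y, z) 0)).real {ω : BondConfig (Fin n) | (∃ t ∈ T', ω ∈ openConn d t) ∧ (A.filter fun u => ∃ t ∈ T', ω ∈ openConn t u).card ≤ j}) - ((prodBernoulli (Function.update w' s(y, z) 0)).real {ω : BondConfig (Fin n) | (∀ t ∈ T', ω ∉ openConn d₀ t) ∧ (A.filter fun u => ω ∈ openConn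 d₀ u).card ≤ j} + (prodBernoulli (Function.update w' s(y, z) 0)).real {ω : BondConfig (Fin n) | (∃ t ∈ T', ω ∈ openConn d₀ t) ∧ (A.filter fun u => ∃ t ∈ T', ω ∈ openConn t u).card ≤ j})) +
            (w' s(y, z) : ℝ) * (((prodBernoulli (Function.update w' s(y, z) c)).real {ω : BondConfig (Fin n) | (∀ t ∈ (insert z T'), ω ∉ openConn d t) ∧ (A.filter fun u => ω ∈ openConn d u).card ≤ j} + (prodBernoulli (Function.update w' s(y, z) c)).real {ω : BondConfig (Fin n) | (∃ t ∈ (insert z T'), ω ∈ openConn d t) ∧ (A.filter fun u => ∃ t ∈ (insert z T'), ω ∈ openConn t u).card ≤ j}) - ((prodBernoulli (Function.update w' s(y, z) c)).real {ω : BondConfig (Fin n) | (∀ t ∈ (insert z T'), ω ∉ openConn d₁ t) ∧ (A.filter fun u => ω ∈ openConn d₁ u).card ≤ j} + (prodBernoulli (Function.update w' s(y, z) c)).real {ω : BondConfig (Fin n) | (∃ t ∈ (insert z T'), ω ∈ openConn d₁ t) ∧ (A.filter fun u => ∃ t ∈ (insert z T'), ω ∈ openConn t u).card ≤ j})))) 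→
        Good w {x} a₀ 0) :
    ∀ (n : ℕ) (w : Sym2 (Fin n) → unitInterval) (A : Finset (Fin n)) (j : ℕ) (x a₀ : Fin n),
      x ∉ A → a₀ ∈ A →
      (∀ b ∈ A, (prodBernoulli w).real {ω : BondConfig (Fin n) | (A.filter fun u => ω ∈ openConn b u).card ≤ j} ≤
        (prodBernoulli w).real {ω : BondConfig (Fin n) | (A.filter fun u => ω ∈ openConn a₀ u).card ≤ j}) →
      0 ≤ ((prodBernoulli w).real {ω : BondConfig (Fin n) | (∀ t ∈ ({x} : Finset (Fin n)), ω ∉ openConn a₀ t) ∧ (A.filter fun u => ω ∈ openConn a₀ u).card ≤ j} -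
          (prodBernoulli w).real {ω : BondConfig (Fin n) | (∀ t ∈ ({x} : Finset (Fin n)), ω ∉ openConn a₀ t) ∧ 1 ≤ (A.filter fun u => ∃ t ∈ ({x} : Finset (Fin n)), ω ∈ openConn t u).card ∧ (A.filter fun u => ∃ t ∈ ({x} : Finset (Fin n)), ω ∈ openConn t u).card ≤ j} -
          (prodBernoulli w).real {ω : BondConfig (Fin n) | (A.filter fun u => ∃ t ∈ ({x} : Finset (Fin n)), ω ∈ openConn t u).card = 0 ∧ (A.filter fun u => ω ∈ openConn a₀ u).card ≤ j}) := by
  intro n w A j x a₀ hx ha₀ hch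
  have key := hCert n w A j x a₀ hx ha₀ hch
    (fun w' T' d β => β ≤ ((prodBernoulli w').real {ω : BondConfig (Fin n) | (∀ t ∈ T', ω ∉ openConn d t) ∧ (A.filter fun u => ω ∈ openConn d u).card ≤ j} -
          (prodBernoulli w').real {ω : BondConfig (Fin n) | (∀ t ∈ T', ω ∉ openConn d t) ∧ 1 ≤ (A.filter fun u => ∃ t ∈ T', ω ∈ openConn t u).card ∧ (A.filter fun u => ∃ t ∈ T', ω ∈ openConn t u).card ≤ j} -
          (prodBernoulli w').real {ω : BondConfig (Fin n) | (A.filter fun u => ∃ t ∈ T', ω ∈ openConn t u).card = 0 ∧ (A.filter fun u => ω ∈ openConn a₀ u).card ≤ j}))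
  refine key ?_ ?_ ?_ ?_ ?_
  · -- (mono)
    intro w' T' d β β' h hle
    exact hle.trans h
  · -- (base)
    intro w' T' d hT'A hd hbd
    refine base_ge w' T' A hT'A hd j fun y hy z hz => ?_
    rw [hbd y hy z hz]
    rfl
  · -- (relay leaf)
    intro w' T' d r hrT hrA hle
    exact relay_leaf_nonneg w' T' A hrT hrA j hle
  · -- (pivot on an arbitrary pair)
    intro w' T' d d₀ d₁ e β₀ β₁ hd hd₀ hd₁ _ _ h0 h1
    have ob1 := stub_oneBondDecomp_k15 n w' e {ω : BondConfig (Fin n) | (∀ t ∈ T', ω ∉ openConn d t) ∧ (A.filter fun u => ω ∈ openConn d u).card ≤ j}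
    have ob2 := stub_oneBondDecomp_k15 n w' e {ω : BondConfig (Fin n) | (∀ t ∈ T', ω ∉ openConn d t) ∧ 1 ≤ (A.filter fun u => ∃ t ∈ T', ω ∈ openConn t u).card ∧ (A.filter fun u => ∃ t ∈ T', ω ∈ openConn t u).card ≤ j}
    have ob3 := stub_oneBondDecomp_k15 n w' e {ω : BondConfig (Fin n) | (A.filter fun u => ∃ t ∈ T', ω ∈ openConn t u).card = 0 ∧ (A.filter fun u => ω ∈ openConn a₀ u).card ≤ j}
    have sw0 := real_E2_eq (prodBernoulli (Function.update w' e 0)) T' A hd j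
    have sw1 := real_E2_eq (prodBernoulli (Function.update w' e 1)) T' A hd j
    have sw2 := real_E2_eq (prodBernoulli (Function.update w' e 0)) T' A hd₀ j
    have sw3 := real_E2_eq (prodBernoulli (Function.update w' e 1)) T' A hd₁ j
    have hp0 : 0 ≤ (w' e : ℝ) := (w' e).2.1
    have hp1 : (w' e : ℝ) ≤ 1 := (w' e).2.2
    rw [ob1, ob2, ob3, sw0, sw1]
    rw [sw2] at h0
    rw [sw3] at h1
    have e0 := mul_le_mul_of_nonneg_left h0 (sub_nonneg.2 hp1)
    have e1 := mul_le_mul_of_nonneg_left h1 hp0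
    nlinarith [e0, e1]
  · -- (absorbing pivot)
    intro w' T' d d₀ d₁ y z c β₀ β₁ hd hd₀ hd₁ hy hz hc _ _ h0 h1
    have hyz : y ≠ z := fun h => hz (h ▸ hy)
    have ob1 := real_eq_oneBond_shift w' s(y, z) _ _ (preimage_insert_E1 hyz T' A hy d j)
    have ob2 := real_eq_oneBond_shift w' s(y, z) _ _ (preimage_insert_E2 hyz T' A hy d j)
    have ob3 := real_eq_oneBond_shift w' s(y, z) _ _ (preimage_insert_E3 hyz T' A hy ha₀ j)
    have sw0 := real_E2_eq (prodBernoulli (Function.update w' s(y, z) 0)) T' A hd j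
    have sw1 := real_E2_eq (prodBernoulli (Function.update w' s(y, z) 0)) (insert z T') A hd j
    have sw2 := real_E2_eq (prodBernoulli (Function.update w' s(y, z) 0)) T' A hd₀ j
    have hp0 : 0 ≤ (w' s(y, z) : ℝ) := (w' s(y, z)).2.1
    have hp1 : (w' s(y, z) : ℝ) ≤ 1 := (w' s(y, z)).2.2
    -- read the `c`-child in the convention `c = 0`
    have hc' : (prodBernoulli (Function.update w' s(y, z) c)).real {ω : BondConfig (Fin n) | (∀ t ∈ (insert z T'), ω ∉ openConn d₁ t) ∧ (A.filter fun u => ω ∈ openConn d₁ u).card ≤ j} =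
          (prodBernoulli (Function.update w' s(y, z) 0)).real {ω : BondConfig (Fin n) | (∀ t ∈ (insert z T'), ω ∉ openConn d₁ t) ∧ (A.filter fun u => ω ∈ openConn d₁ u).card ≤ j} ∧
        (prodBernoulli (Function.update w' s(y, z) c)).real {ω : BondConfig (Fin n) | (∀ t ∈ (insert z T'), ω ∉ openConn d₁ t) ∧ 1 ≤ (A.filter fun u => ∃ t ∈ (insert z T'), ω ∈ openConn t u).card ∧ (A.filter fun u => ∃ t ∈ (insert z T'), ω ∈ openConn t u).card ≤ j} =
          (prodBernoulli (Function.update w' s(y, z) 0)).real {ω : BondConfig (Fin n) | (∀ t ∈ (insert z T'), ω ∉ openConn d₁ t) ∧ 1 ≤ (A.filter fun u => ∃ t ∈ (insert z T'), ω ∈ openConn t u).card ∧ (A.filter fun u => ∃ t ∈ (insert z T'), ω ∈ openConn t u).card ≤ j} ∧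
        (prodBernoulli (Function.update w' s(y, z) c)).real {ω : BondConfig (Fin n) | (A.filter fun u => ∃ t ∈ (insert z T'), ω ∈ openConn t u).card = 0 ∧ (A.filter fun u => ω ∈ openConn a₀ u).card ≤ j} =
          (prodBernoulli (Function.update w' s(y, z) 0)).real {ω : BondConfig (Fin n) | (A.filter fun u => ∃ t ∈ (insert z T'), ω ∈ openConn t u).card = 0 ∧ (A.filter fun u => ω ∈ openConn a₀ u).card ≤ j} ∧
        (prodBernoulli (Function.update w' s(y, z) c)).real {ω : BondConfig (Fin n) | (∃ t ∈ (insert z T'), ω ∈ openConn d₁ t) ∧ (A.filter fun u => ∃ t ∈ (insert z T'), ω ∈ openConn t u).card ≤ j} =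
          (prodBernoulli (Function.update w' s(y, z) 0)).real {ω : BondConfig (Fin n) | (∃ t ∈ (insert z T'), ω ∈ openConn d₁ t) ∧ (A.filter fun u => ∃ t ∈ (insert z T'), ω ∈ openConn t u).card ≤ j} ∧
        (prodBernoulli (Function.update w' s(y, z) c)).real {ω : BondConfig (Fin n) | (∀ t ∈ (insert z T'), ω ∉ openConn d t) ∧ (A.filter fun u => ω ∈ openConn d u).card ≤ j} =
          (prodBernoulli (Function.update w' s(y, z) 0)).real {ω : BondConfig (Fin n) | (∀ t ∈ (insert z T'), ω ∉ openConn d t) ∧ (A.filter fun u => ω ∈ openConn d u).card ≤ j} ∧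
        (prodBernoulli (Function.update w' s(y, z) c)).real {ω : BondConfig (Fin n) | (∃ t ∈ (insert z T'), ω ∈ openConn d t) ∧ (A.filter fun u => ∃ t ∈ (insert z T'), ω ∈ openConn t u).card ≤ j} =
          (prodBernoulli (Function.update w' s(y, z) 0)).real {ω : BondConfig (Fin n) | (∃ t ∈ (insert z T'), ω ∈ openConn d t) ∧ (A.filter fun u => ∃ t ∈ (insert z T'), ω ∈ openConn t u).card ≤ j} := by
      rcases hc with rfl | rfl
      · exact ⟨rfl, rfl, rfl, rfl, rfl, rfl⟩
      · obtain ⟨a1, a2, a3, a4⟩ := real_update_one_eq_zero_of_absorbed w' T' A hyz hy d₁ a₀ ha₀ j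
        obtain ⟨b1, -, -, b4⟩ := real_update_one_eq_zero_of_absorbed w' T' A hyz hy d a₀ ha₀ j
        exact ⟨a1, a2, a3, a4, b1, b4⟩
    obtain ⟨c1, c2, c3, c4, c5, c6⟩ := hc'
    rw [c5, c6]
    rw [c1, c2, c3] at h1
    have sw3 := real_E2_eq (prodBernoulli (Function.update w' s(y, z) 0)) (insert z T') A hd₁ j
    rw [ob1, ob2, ob3, sw0, sw1]
    rw [sw2] at h0
    rw [sw3] at h1
    have e0 := mul_le_mul_of_nonneg_left h0 (sub_nonneg.2 hp1)
    have e1 := mul_le_mul_of_nonneg_left h1 hp0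
    nlinarith [e0, e1, c4]

/-- **Pivot certificates close the cumulative isolation lemma** (`stub_cumulativeIsolation` verbatim): at every free observer the champion is a
valid witness, by `cst_of_championCertificate` and the bookkeeping `μ{1 ≤ N ≤ j} ≤ μE₂({o},i) + (I(i) − μE₁({o},i))`. -/
theorem cumulativeIsolation_of_championCertificate
    (hCert : ∀ (n : ℕ) (w : Sym2 (Fin n) → unitInterval) (A : Finset (Fin n)) (j : ℕ) (x a₀ : Fin n),
      x ∉ A → a₀ ∈ A →
      (∀ b ∈ A, (prodBernoulli w).real {ω : BondConfig (Fin n) | (A.filter fun u => ω ∈ openConn b u).card ≤ j} ≤ (prodBernoulli w).real {ω : BondConfig (Fin n) | (A.filter fun u => ω ∈ openConn a₀ u).card ≤ j}) →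
      ∀ Good : (Sym2 (Fin n) → unitInterval) → Finset (Fin n) → Fin n → ℝ → Prop,
        (∀ (w' : Sym2 (Fin n) → unitInterval) (T' : Finset (Fin n)) (d : Fin n) (β β' : ℝ),
          Good w' T' d β → β' ≤ β → Good w' T' d β') →
        (∀ (w' : Sym2 (Fin n) → unitInterval) (T' : Finset (Fin n)) (d : Fin n), Disjoint T' A → d ∈ A →
          (∀ y ∈ T', ∀ z : Fin n, z ∉ T' → w' s(y, z) = 0) →
          Good w' T' d ((prodBernoulli w').real {ω : BondConfig (Fin n) | (A.filter fun u => ω ∈ openConn d u).card ≤ j} - (prodBernoulli w').real {ω : BondConfig (Fin n) | (A.filter fun u => ω ∈ openConn a₀ u).card ≤ j})) →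
        (∀ (w' : Sym2 (Fin n) → unitInterval) (T' : Finset (Fin n)) (d r : Fin n), r ∈ T' → r ∈ A →
          (prodBernoulli w').real {ω : BondConfig (Fin n) | (A.filter fun u => ω ∈ openConn r u).card ≤ j} ≤ (prodBernoulli w').real {ω : BondConfig (Fin n) | (A.filter fun u => ω ∈ openConn d u).card ≤ j} →
          Good w' T' d 0) →
        (∀ (w' : Sym2 (Fin n) → unitInterval) (T' : Finset (Fin n)) (d d₀ d₁ : Fin n) (e : Sym2 (Fin n)) (β₀ β₁ : ℝ),
          d ∈ A → d₀ ∈ A → d₁ ∈ A →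
          (∀ b ∈ A, (prodBernoulli (Function.update w' e 0)).real {ω : BondConfig (Fin n) | (A.filter fun u => ω ∈ openConn b u).card ≤ j} ≤ (prodBernoulli (Function.update w' e 0)).real {ω : BondConfig (Fin n) | (A.filter fun u => ω ∈ openConn d₀ u).card ≤ j}) →
          (∀ b ∈ A, (prodBernoulli (Function.update w' e 1)).real {ω : BondConfig (Fin n) | (A.filter fun u => ω ∈ openConn b u).card ≤ j} ≤ (prodBernoulli (Function.update w' e 1)).real {ω : BondConfig (Fin n) | (A.filter fun u => ω ∈ openConn d₁ u).card ≤ j}) →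
          Good (Function.update w' e 0) T' d₀ β₀ → Good (Function.update w' e 1) T' d₁ β₁ →
          Good w' T' d ((1 - (w' e : ℝ)) * β₀ + (w' e : ℝ) * β₁ +
            (1 - (w' e : ℝ)) * (((prodBernoulli (Function.update w' e 0)).real {ω : BondConfig (Fin n) | (∀ t ∈ T', ω ∉ openConn d t) ∧ (A.filter fun u => ω ∈ openConn d u).card ≤ j} + (prodBernoulli (Function.update w' e 0)).real {ω : BondConfig (Fin n) | (∃ t ∈ T', ω ∈ openConn d t) ∧ (A.filter fun u => ∃ t ∈ T', ω ∈ openConn t u).card ≤ j}) - ((prodBernoulli (Function.update w' e 0)).real {ω : BondConfig (Fin n) | (∀ t ∈ T', ω ∉ openConn d₀ t) ∧ (A.filter fun u => ω ∈ openConn d₀ u).card ≤ j} + (prodBernoulli (Function.update w' e 0)).real {ω : BondConfig (Fin n) | (∃ t ∈ T', ω ∈ openConn d₀ t) ∧ (A.filter fun u => ∃ t ∈ T', ω ∈ openConn t u).card ≤ j})) +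
            (w' e : ℝ) * (((prodBernoulli (Function.update w' e 1)).real {ω : BondConfig (Fin n) | (∀ t ∈ T', ω ∉ openConn d t) ∧ (A.filter fun u => ω ∈ openConn d u).card ≤ j} + (prodBernoulli (Function.update w' e 1)).real {ω : BondConfig (Fin n) | (∃ t ∈ T', ω ∈ openConn d t) ∧ (A.filter fun u => ∃ t ∈ T', ω ∈ openConn t u).card ≤ j}) - ((prodBernoulli (Function.update w' e 1)).real {ω : BondConfig (Fin n) | (∀ t ∈ T', ω ∉ openConn d₁ t) ∧ (A.filter fun u => ω ∈ openConn d₁ u).card ≤ j} + (prodBernoulli (Function.update w' e 1)).real {ω : BondConfig (Fin n) | (∃ t ∈ T', ω ∈ openConn d₁ t) ∧ (A.filter fun u => ∃ t ∈ T', ω ∈ openConn t u).card ≤ j})))) →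
        (∀ (w' : Sym2 (Fin n) → unitInterval) (T' : Finset (Fin n)) (d d₀ d₁ y z : Fin n) (c : unitInterval) (β₀ β₁ : ℝ),
          d ∈ A → d₀ ∈ A → d₁ ∈ A → y ∈ T' → z ∉ T' → (c = 0 ∨ c = 1) →
          (∀ b ∈ A, (prodBernoulli (Function.update w' s(y, z) 0)).real {ω : BondConfig (Fin n) | (A.filter fun u => ω ∈ openConn b u).card ≤ j} ≤ (prodBernoulli (Function.update w' s(y, z) 0)).real {ω : BondConfig (Fin n) | (A.filter fun u => ω ∈ openConn d₀ u).card ≤ j}) →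
          (∀ b ∈ A, (prodBernoulli (Function.update w' s(y, z) c)).real {ω : BondConfig (Fin n) | (A.filter fun u => ω ∈ openConn b u).card ≤ j} ≤ (prodBernoulli (Function.update w' s(y, z) c)).real {ω : BondConfig (Fin n) | (A.filter fun u => ω ∈ openConn d₁ u).card ≤ j}) →
          Good (Function.update w' s(y, z) 0) T' d₀ β₀ → Good (Function.update w' s(y, z) c) (insert z T') d₁ β₁ →
          Good w' T' d ((1 - (w' s(y, z) : ℝ)) * β₀ + (w' s(y, z) : ℝ) * β₁ +
            (1 - (w' s(y, z) : ℝ)) * (((prodBernoulli (Function.update w' s(y, z) 0)).real {ω : BondConfig (Fin n) | (∀ t ∈ T', ω ∉ openConn d t) ∧ (A.filter fun u => ω ∈ openConn d u).card ≤ j} + (prodBernoulli (Function.update w' s(y, z) 0)).real {ω : BondConfig (Fin n) | (∃ t ∈ T', ω ∈ openConn d t) ∧ (A.filter fun u => ∃ t ∈ T', ω ∈ openConn t u).card ≤ j}) - ((prodBernoulli (Function.update w' s(y, z) 0)).real {ω : BondConfig (Fin n) | (∀ t ∈ T', ω ∉ openConn d₀ t) ∧ (A.filter fun u => ω ∈ openConn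 d₀ u).card ≤ j} + (prodBernoulli (Function.update w' s(y, z) 0)).real {ω : BondConfig (Fin n) | (∃ t ∈ T', ω ∈ openConn d₀ t) ∧ (A.filter fun u => ∃ t ∈ T', ω ∈ openConn t u).card ≤ j})) +
            (w' s(y, z) : ℝ) * (((prodBernoulli (Function.update w' s(y, z) c)).real {ω : BondConfig (Fin n) | (∀ t ∈ (insert z T'), ω ∉ openConn d t) ∧ (A.filter fun u => ω ∈ openConn d u).card ≤ j} + (prodBernoulli (Function.update w' s(y, z) c)).real {ω : BondConfig (Fin n) | (∃ t ∈ (insert z T'), ω ∈ openConn d t) ∧ (A.filter fun u => ∃ t ∈ (insert z T'), ω ∈ openConn t u).card ≤ j}) - ((prodBernoulli (Function.update w' s(y, z) c)).real {ω : BondConfig (Fin n) | (∀ t ∈ (insert z T'), ω ∉ openConn d₁ t) ∧ (A.filter fun u => ω ∈ openConn d₁ u).card ≤ j} + (prodBernoulli (Function.update w' s(y, z) c)).real {ω : BondConfig (Fin n) | (∃ t ∈ (insert z T'), ω ∈ openConn d₁ t) ∧ (A.filter fun u => ∃ t ∈ (insert z T'), ω ∈ openConn t u).card ≤ j})))) 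→
        Good w {x} a₀ 0) :
    ∀ (n : ℕ) (w : Sym2 (Fin n) → unitInterval) (A : Finset (Fin n)) (o : Fin n) (j : ℕ),
      A.Nonempty → o ∉ A → ∃ a ∈ A,
        (Literature.Probability.LatticeModels.prodBernoulli w).real
            {ω : Literature.Probability.Percolation.BondConfig (Fin n) |
              1 ≤ (A.filter fun x => ω ∈ Literature.Probability.Percolation.openConn o x).card ∧
                (A.filter fun x => ω ∈ Literature.Probability.Percolation.openConn o x).card ≤ j} ≤
          (Literature.Probability.LatticeModels.prodBernoulli w).real
            {ω : Literature.Probability.Percolation.BondConfig (Fin n) |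
              (A.filter fun x => ω ∈ Literature.Probability.Percolation.openConn a x).card ≤ j} := by
  intro n w A o j hA ho
  obtain ⟨i, hi, hch⟩ := MergeStability.exists_champion (prodBernoulli w) A hA j
  refine ⟨i, hi, ?_⟩
  have key := cst_of_championCertificate hCert n w A j o i ho hi hch
  have hmeas : ∀ S : Set (BondConfig (Fin n)), MeasurableSet S := fun S => (Set.toFinite S).measurableSet
  have hpi : ∀ ω : BondConfig (Fin n), (A.filter fun x => ∃ t ∈ ({o} : Finset (Fin n)), ω ∈ openConn t x) =
      (A.filter fun x => ω ∈ openConn o x) := by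
    intro ω
    apply Finset.filter_congr
    intro x _
    simp only [Finset.mem_singleton, exists_eq_left]
  have hsplit : (prodBernoulli w).real {ω : BondConfig (Fin n) | 1 ≤ (A.filter fun x => ω ∈ openConn o x).card ∧
      (A.filter fun x => ω ∈ openConn o x).card ≤ j} ≤
      (prodBernoulli w).real {ω : BondConfig (Fin n) | (∀ t ∈ ({o} : Finset (Fin n)), ω ∉ openConn i t) ∧ 1 ≤ (A.filter fun u => ∃ t ∈ ({o} : Finset (Fin n)), ω ∈ openConn t u).card ∧ (A.filter fun u => ∃ t ∈ ({o} : Finset (Fin n)), ω ∈ openConn t u).card ≤ j} +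
        (prodBernoulli w).real ({ω : BondConfig (Fin n) | (A.filter fun u => ω ∈ openConn i u).card ≤ j} \
          {ω : BondConfig (Fin n) | (∀ t ∈ ({o} : Finset (Fin n)), ω ∉ openConn i t) ∧ (A.filter fun u => ω ∈ openConn i u).card ≤ j}) := by
    calc (prodBernoulli w).real {ω : BondConfig (Fin n) | 1 ≤ (A.filter fun x => ω ∈ openConn o x).card ∧
          (A.filter fun x => ω ∈ openConn o x).card ≤ j}
        ≤ (prodBernoulli w).real ({ω : BondConfig (Fin n) | (∀ t ∈ ({o} : Finset (Fin n)), ω ∉ openConn i t) ∧ 1 ≤ (A.filter fun u => ∃ t ∈ ({o} : Finset (Fin n)), ω ∈ openConn t u).card ∧ (A.filter fun u => ∃ t ∈ ({o} : Finset (Fin n)), ω ∈ openConn t u).card ≤ j} ∪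
            ({ω : BondConfig (Fin n) | (A.filter fun u => ω ∈ openConn i u).card ≤ j} \
              {ω : BondConfig (Fin n) | (∀ t ∈ ({o} : Finset (Fin n)), ω ∉ openConn i t) ∧ (A.filter fun u => ω ∈ openConn i u).card ≤ j})) := by
          refine measureReal_mono (fun ω hω => ?_) (measure_ne_top _ _)
          obtain ⟨h1, h2⟩ := hω
          by_cases hc : ω ∈ openConn i o
          · right
            refine ⟨?_, fun h => h.1 o (Finset.mem_singleton_self o) hc⟩
            have heq : (A.filter fun x => ω ∈ openConn i x) = (A.filter fun x => ω ∈ openConn o x) := by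
              apply Finset.filter_congr
              intro x _
              simp only [mem_openConn_iff_reachable] at hc ⊢
              exact ⟨fun h => hc.symm.trans h, fun h => hc.trans h⟩
            show (A.filter fun x => ω ∈ openConn i x).card ≤ j
            rw [heq]; exact h2
          · left
            refine ⟨fun t ht => ?_, ?_, ?_⟩
            · rw [Finset.mem_singleton.1 ht]; exact hc
            · rw [hpi ω]; exact h1
            · rw [hpi ω]; exact h2
      _ ≤ _ := measureReal_union_le _ _
  have hdiff : (prodBernoulli w).real ({ω : BondConfig (Fin n) | (A.filter fun u => ω ∈ openConn i u).card ≤ j} \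
          {ω : BondConfig (Fin n) | (∀ t ∈ ({o} : Finset (Fin n)), ω ∉ openConn i t) ∧ (A.filter fun u => ω ∈ openConn i u).card ≤ j}) =
      (prodBernoulli w).real {ω : BondConfig (Fin n) | (A.filter fun u => ω ∈ openConn i u).card ≤ j} -
        (prodBernoulli w).real {ω : BondConfig (Fin n) | (∀ t ∈ ({o} : Finset (Fin n)), ω ∉ openConn i t) ∧ (A.filter fun u => ω ∈ openConn i u).card ≤ j} :=
    measureReal_sdiff (fun ω hω => hω.2) (hmeas _)
  have hE3 : 0 ≤ (prodBernoulli w).real {ω : BondConfig (Fin n) | (A.filter fun u => ∃ t ∈ ({o} : Finset (Fin n)), ω ∈ openConn t u).card = 0 ∧ (A.filter fun u => ω ∈ openConn i u).card ≤ j} := measureReal_nonneg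
  linarith

/-- **Pivot certificates close the crux**: `hCert → NoHeavyLowerTail`, through `cumulativeIsolation_of_championCertificate` and the landed
`noHeavyLowerTail_of_stub_cumulativeIsolation`. -/
theorem noHeavyLowerTail_of_championCertificate
    (hCert : ∀ (n : ℕ) (w : Sym2 (Fin n) → unitInterval) (A : Finset (Fin n)) (j : ℕ) (x a₀ : Fin n),
      x ∉ A → a₀ ∈ A →
      (∀ b ∈ A, (prodBernoulli w).real {ω : BondConfig (Fin n) | (A.filter fun u => ω ∈ openConn b u).card ≤ j} ≤ (prodBernoulli w).real {ω : BondConfig (Fin n) | (A.filter fun u => ω ∈ openConn a₀ u).card ≤ j}) →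
      ∀ Good : (Sym2 (Fin n) → unitInterval) → Finset (Fin n) → Fin n → ℝ → Prop,
        (∀ (w' : Sym2 (Fin n) → unitInterval) (T' : Finset (Fin n)) (d : Fin n) (β β' : ℝ),
          Good w' T' d β → β' ≤ β → Good w' T' d β') →
        (∀ (w' : Sym2 (Fin n) → unitInterval) (T' : Finset (Fin n)) (d : Fin n), Disjoint T' A → d ∈ A →
          (∀ y ∈ T', ∀ z : Fin n, z ∉ T' → w' s(y, z) = 0) →
          Good w' T' d ((prodBernoulli w').real {ω : BondConfig (Fin n) | (A.filter fun u => ω ∈ openConn d u).card ≤ j} - (prodBernoulli w').real {ω : BondConfig (Fin n) | (A.filter fun u => ω ∈ openConn a₀ u).card ≤ j})) →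
        (∀ (w' : Sym2 (Fin n) → unitInterval) (T' : Finset (Fin n)) (d r : Fin n), r ∈ T' → r ∈ A →
          (prodBernoulli w').real {ω : BondConfig (Fin n) | (A.filter fun u => ω ∈ openConn r u).card ≤ j} ≤ (prodBernoulli w').real {ω : BondConfig (Fin n) | (A.filter fun u => ω ∈ openConn d u).card ≤ j} →
          Good w' T' d 0) →
        (∀ (w' : Sym2 (Fin n) → unitInterval) (T' : Finset (Fin n)) (d d₀ d₁ : Fin n) (e : Sym2 (Fin n)) (β₀ β₁ : ℝ),
          d ∈ A → d₀ ∈ A → d₁ ∈ A →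
          (∀ b ∈ A, (prodBernoulli (Function.update w' e 0)).real {ω : BondConfig (Fin n) | (A.filter fun u => ω ∈ openConn b u).card ≤ j} ≤ (prodBernoulli (Function.update w' e 0)).real {ω : BondConfig (Fin n) | (A.filter fun u => ω ∈ openConn d₀ u).card ≤ j}) →
          (∀ b ∈ A, (prodBernoulli (Function.update w' e 1)).real {ω : BondConfig (Fin n) | (A.filter fun u => ω ∈ openConn b u).card ≤ j} ≤ (prodBernoulli (Function.update w' e 1)).real {ω : BondConfig (Fin n) | (A.filter fun u => ω ∈ openConn d₁ u).card ≤ j}) →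
          Good (Function.update w' e 0) T' d₀ β₀ → Good (Function.update w' e 1) T' d₁ β₁ →
          Good w' T' d ((1 - (w' e : ℝ)) * β₀ + (w' e : ℝ) * β₁ +
            (1 - (w' e : ℝ)) * (((prodBernoulli (Function.update w' e 0)).real {ω : BondConfig (Fin n) | (∀ t ∈ T', ω ∉ openConn d t) ∧ (A.filter fun u => ω ∈ openConn d u).card ≤ j} + (prodBernoulli (Function.update w' e 0)).real {ω : BondConfig (Fin n) | (∃ t ∈ T', ω ∈ openConn d t) ∧ (A.filter fun u => ∃ t ∈ T', ω ∈ openConn t u).card ≤ j}) - ((prodBernoulli (Function.update w' e 0)).real {ω : BondConfig (Fin n) | (∀ t ∈ T', ω ∉ openConn d₀ t) ∧ (A.filter fun u => ω ∈ openConn d₀ u).card ≤ j} + (prodBernoulli (Function.update w' e 0)).real {ω : BondConfig (Fin n) | (∃ t ∈ T', ω ∈ openConn d₀ t) ∧ (A.filter fun u => ∃ t ∈ T', ω ∈ openConn t u).card ≤ j})) +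
            (w' e : ℝ) * (((prodBernoulli (Function.update w' e 1)).real {ω : BondConfig (Fin n) | (∀ t ∈ T', ω ∉ openConn d t) ∧ (A.filter fun u => ω ∈ openConn d u).card ≤ j} + (prodBernoulli (Function.update w' e 1)).real {ω : BondConfig (Fin n) | (∃ t ∈ T', ω ∈ openConn d t) ∧ (A.filter fun u => ∃ t ∈ T', ω ∈ openConn t u).card ≤ j}) - ((prodBernoulli (Function.update w' e 1)).real {ω : BondConfig (Fin n) | (∀ t ∈ T', ω ∉ openConn d₁ t) ∧ (A.filter fun u => ω ∈ openConn d₁ u).card ≤ j} + (prodBernoulli (Function.update w' e 1)).real {ω : BondConfig (Fin n) | (∃ t ∈ T', ω ∈ openConn d₁ t) ∧ (A.filter fun u => ∃ t ∈ T', ω ∈ openConn t u).card ≤ j})))) →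
        (∀ (w' : Sym2 (Fin n) → unitInterval) (T' : Finset (Fin n)) (d d₀ d₁ y z : Fin n) (c : unitInterval) (β₀ β₁ : ℝ),
          d ∈ A → d₀ ∈ A → d₁ ∈ A → y ∈ T' → z ∉ T' → (c = 0 ∨ c = 1) →
          (∀ b ∈ A, (prodBernoulli (Function.update w' s(y, z) 0)).real {ω : BondConfig (Fin n) | (A.filter fun u => ω ∈ openConn b u).card ≤ j} ≤ (prodBernoulli (Function.update w' s(y, z) 0)).real {ω : BondConfig (Fin n) | (A.filter fun u => ω ∈ openConn d₀ u).card ≤ j}) →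
          (∀ b ∈ A, (prodBernoulli (Function.update w' s(y, z) c)).real {ω : BondConfig (Fin n) | (A.filter fun u => ω ∈ openConn b u).card ≤ j} ≤ (prodBernoulli (Function.update w' s(y, z) c)).real {ω : BondConfig (Fin n) | (A.filter fun u => ω ∈ openConn d₁ u).card ≤ j}) →
          Good (Function.update w' s(y, z) 0) T' d₀ β₀ → Good (Function.update w' s(y, z) c) (insert z T') d₁ β₁ →
          Good w' T' d ((1 - (w' s(y, z) : ℝ)) * β₀ + (w' s(y, z) : ℝ) * β₁ +
            (1 - (w' s(y, z) : ℝ)) * (((prodBernoulli (Function.update w' s(y, z) 0)).real {ω : BondConfig (Fin n) | (∀ t ∈ T', ω ∉ openConn d t) ∧ (A.filter fun u => ω ∈ openConn d u).card ≤ j} + (prodBernoulli (Function.update w' s(y, z) 0)).real {ω : BondConfig (Fin n) | (∃ t ∈ T', ω ∈ openConn d t) ∧ (A.filter fun u => ∃ t ∈ T', ω ∈ openConn t u).card ≤ j}) - ((prodBernoulli (Function.update w' s(y, z) 0)).real {ω : BondConfig (Fin n) | (∀ t ∈ T', ω ∉ openConn d₀ t) ∧ (A.filter fun u => ω ∈ openConn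 d₀ u).card ≤ j} + (prodBernoulli (Function.update w' s(y, z) 0)).real {ω : BondConfig (Fin n) | (∃ t ∈ T', ω ∈ openConn d₀ t) ∧ (A.filter fun u => ∃ t ∈ T', ω ∈ openConn t u).card ≤ j})) +
            (w' s(y, z) : ℝ) * (((prodBernoulli (Function.update w' s(y, z) c)).real {ω : BondConfig (Fin n) | (∀ t ∈ (insert z T'), ω ∉ openConn d t) ∧ (A.filter fun u => ω ∈ openConn d u).card ≤ j} + (prodBernoulli (Function.update w' s(y, z) c)).real {ω : BondConfig (Fin n) | (∃ t ∈ (insert z T'), ω ∈ openConn d t) ∧ (A.filter fun u => ∃ t ∈ (insert z T'), ω ∈ openConn t u).card ≤ j}) - ((prodBernoulli (Function.update w' s(y, z) c)).real {ω : BondConfig (Fin n) | (∀ t ∈ (insert z T'), ω ∉ openConn d₁ t) ∧ (A.filter fun u => ω ∈ openConn d₁ u).card ≤ j} + (prodBernoulli (Function.update w' s(y, z) c)).real {ω : BondConfig (Fin n) | (∃ t ∈ (insert z T'), ω ∈ openConn d₁ t) ∧ (A.filter fun u => ∃ t ∈ (insert z T'), ω ∈ openConn t u).card ≤ j})))) 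→
        Good w {x} a₀ 0) :
    Summit.CriticalPhenomena.PercolationContinuityZ3.Theses.PercNearOneGluing.NoHeavyLowerTail :=
  noHeavyLowerTail_of_stub_cumulativeIsolation (cumulativeIsolation_of_championCertificate hCert)

end Summit.CriticalPhenomena.PercolationContinuityZ3.Theorems

end
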